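import Mathlib.FieldTheory.KrullTopology
import Mathlib.RingTheory.RootsOfUnity.AlgebraicallyClosed
import Mathlib.NumberTheory.Cyclotomic.Gal
import Mathlib.NumberTheory.Cyclotomic.CyclotomicCharacter
import Mathlib.Data.Nat.Factorization.Basic
import Literature.NumberTheory.GaloisRepresentations.GaloisRep
import HarnessLib

/-!
# Surjectivity of the cyclotomic character over a field with irreducible cyclotomic polynomials
(proofs only)

For a field `K` of characteristic `0` over which *every* cyclotomic polynomial `Φₙ` is irreducible
(`K = ℚ`: Mathlib's `Polynomial.cyclotomic.irreducible_rat`) we prove, for the action of the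
absolute Galois group `Γ_K = Field.absoluteGaloisGroup K` on the roots of unity of `K̄`:

* `Literature.NumberTheory.GaloisRepresentations.RootOfUnityAction.exists_smul_eq_pow_and_smul_eq_self`: for coprime `A, B ≥ 1` and a unit
  `a mod A` there is `σ ∈ Γ_K` acting on `μ_A(K̄)` by `ζ ↦ ζᵃ` and trivially on `μ_B(K̄)`
  (`Gal(K(μ_{AB})/K) ≃ (ℤ/AB)ˣ`, Mathlib's `IsCyclotomicExtension.autEquivPow`, the Chinese
  remainder theorem, and extension of automorphisms to `K̄`, `AlgEquiv.liftNormal`);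
* `Literature.NumberTheory.GaloisRepresentations.RootOfUnityAction.exists_smul_eq_smul_and_smul_eq_self`: for a prime `ℓ` and `τ ∈ Γ_K`
  there is `σ ∈ Γ_K` acting like `τ` on `μ_{ℓ^∞}(K̄)` and trivially on all roots of unity of order
  prime to `ℓ` (the previous item at the levels `ℓʲ · (j!)_{(ℓ')}` and compactness of `Γ_K`), i.e.
  `Gal(K(μ_∞)/K) → ∏_ℓ ℤ_ℓˣ` hits the elements supported at one prime;
* `Literature.NumberTheory.GaloisRepresentations.GaloisRep.cyclotomicCharacter_surjective`: the `p`-adic cyclotomic character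
  `χ_p : Γ_K →ₜ* ℤ_pˣ` (`Literature.NumberTheory.GaloisRepresentations.GaloisRep.cyclotomicCharacter`) is surjective, and
  `Literature.NumberTheory.GaloisRepresentations.GaloisRep.exists_continuousMonoidHom_comp_cyclotomicCharacter`: a continuous homomorphism
  on `Γ_K` that is trivial on `ker χ_p` factors continuously through `χ_p` (`χ_p` is a quotient map,
  `Γ_K` being compact).

Also elementary bookkeeping for "`σ` fixes the `m`-th roots of unity of `K̄`"
(`∀ ζ, ζ ^ m = 1 → σ • ζ = ζ`): closedness in the Krull topology, gluing over coprime moduli,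
`σ ^ φ(N)` fixes `μ_N`.

These are the Galois-theoretic inputs (besides the Kronecker–Weber theorem) for the uniqueness of
the `ℤ_p`-extension of `ℚ` (`Literature/NumberTheory/EllipticCurves/ZpExtensionKroneckerWeberProofs.lean`).

## References

* [Washington1997] L. C. Washington, *Introduction to Cyclotomic Fields*, 2nd ed. (1997), Ch. 2
  (Thm. 2.5: `Gal(ℚ(ζₙ)/ℚ) ≃ (ℤ/nℤ)ˣ`) and §14 (p. 321: `Gal(ℚ(μ_∞)/ℚ) ≃ ∏_p ℤ_pˣ`).
* [SerreAbelianLadic1968] J.-P. Serre, *Abelian `ℓ`-adic representations and elliptic curves*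
  (1968), Ch. I §1.2 (the cyclotomic character).
* Mathlib: `Mathlib/NumberTheory/Cyclotomic/Gal.lean`, `…/CyclotomicCharacter.lean`,
  `Mathlib/FieldTheory/KrullTopology.lean`.
-/

noncomputable section

open Polynomial Field

open scoped IntermediateField

universe u

namespace Literature.NumberTheory.GaloisRepresentations

namespace RootOfUnityAction

variable {K : Type u} [Field K]

/-- For `x, c ∈ K̄` the set `{σ ∈ Γ_K | σ x = c}` is closed in the Krull topology: it is empty or a
left coset of the stabiliser of `x`, an open (hence closed) subgroup
(`stabilizer_isOpen_of_isIntegral`).  Ref: Neukirch, *Algebraic Number Theory*, Ch. IV §1. [folklore] -/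
theorem isClosed_setOf_smul_eq (x c : AlgebraicClosure K) :
    IsClosed {σ : absoluteGaloisGroup K | σ • x = c} := by
  by_cases h : ∃ σ₀ : absoluteGaloisGroup K, σ₀ • x = c
  · obtain ⟨σ₀, rfl⟩ := h
    have hstab : IsClosed ((MulAction.stabilizer (absoluteGaloisGroup K) x :
        Subgroup (absoluteGaloisGroup K)) : Set (absoluteGaloisGroup K)) :=
      Subgroup.isClosed_of_isOpen _
        (stabilizer_isOpen_of_isIntegral (K := K) (L := AlgebraicClosure K) x)
    convert hstab.leftCoset σ₀ using 1
    ext σ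
    rw [Set.mem_setOf_eq, mem_leftCoset_iff, SetLike.mem_coe, MulAction.mem_stabilizer_iff,
      mul_smul, inv_smul_eq_iff]
  · have he : {σ : absoluteGaloisGroup K | σ • x = c} = (∅ : Set (absoluteGaloisGroup K)) := by
      ext σ
      simp only [Set.mem_setOf_eq, Set.mem_empty_iff_false, iff_false]
      exact fun hσ => h ⟨σ, hσ⟩
    rw [he]
    exact isClosed_empty

/-- For `N : ℕ` and any map `g : K̄ → K̄`, the set of `σ ∈ Γ_K` with `σ ζ = g ζ` for every `N`-th
root of unity `ζ ∈ K̄` is closed (an intersection of sets `isClosed_setOf_smul_eq`).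
Ref: Neukirch, *Algebraic Number Theory*, Ch. IV §1. [folklore] -/
theorem isClosed_setOf_forall_smul_eq (N : ℕ) (g : AlgebraicClosure K → AlgebraicClosure K) :
    IsClosed {σ : absoluteGaloisGroup K |
      ∀ ζ : AlgebraicClosure K, ζ ^ N = 1 → σ • ζ = g ζ} := by
  have hset : {σ : absoluteGaloisGroup K | ∀ ζ : AlgebraicClosure K, ζ ^ N = 1 → σ • ζ = g ζ} =
      ⋂ ζ ∈ {ζ : AlgebraicClosure K | ζ ^ N = 1}, {σ : absoluteGaloisGroup K | σ • ζ = g ζ} := by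
    ext σ
    simp only [Set.mem_setOf_eq, Set.mem_iInter]
  rw [hset]
  exact isClosed_biInter fun ζ _ => isClosed_setOf_smul_eq ζ (g ζ)

/-- If `σ ∈ Γ_K` fixes the `M`-th roots of unity of `K̄`, so does every power `σ ^ i`. [folklore] -/
theorem pow_smul_eq_self {M : ℕ} (σ : absoluteGaloisGroup K)
    (h : ∀ ζ : AlgebraicClosure K, ζ ^ M = 1 → σ • ζ = ζ) (i : ℕ)
    (ζ : AlgebraicClosure K) (hζ : ζ ^ M = 1) : σ ^ i • ζ = ζ := by
  induction i with
  | zero => rw [pow_zero, one_smul]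
  | succ i ih => rw [pow_succ, mul_smul, h ζ hζ, ih]

/-- **Gluing over coprime moduli.**  If `σ ∈ Γ_K` fixes the `A`-th and the `B`-th roots of unity
of `K̄`, `A, B ≥ 1` coprime, then it fixes the `AB`-th roots of unity: every `AB`-th root of
unity is a product `ζ = ζᶠ · ζᵉ` of an `A`-th and a `B`-th root of unity
(`f ≡ 1 (A), f ≡ 0 (B)`, `e ≡ 0 (A), e ≡ 1 (B)`, Chinese remainder theorem).
Ref: Washington, *Introduction to Cyclotomic Fields*, Ch. 2 (`ℚ(ζₙ, ζₘ) = ℚ(ζ_{nm})` for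
`(n, m) = 1`). [folklore] -/
theorem smul_eq_self_of_coprime {A B : ℕ} [NeZero A] [NeZero B] (hAB : A.Coprime B)
    (σ : absoluteGaloisGroup K)
    (hA : ∀ ζ : AlgebraicClosure K, ζ ^ A = 1 → σ • ζ = ζ)
    (hB : ∀ ζ : AlgebraicClosure K, ζ ^ B = 1 → σ • ζ = ζ)
    (ζ : AlgebraicClosure K) (hζ : ζ ^ (A * B) = 1) : σ • ζ = ζ := by
  obtain ⟨e, heA, heB⟩ := Nat.chineseRemainder hAB 0 1
  obtain ⟨f, hfA, hfB⟩ := Nat.chineseRemainder hAB 1 0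
  -- `ζ ^ f` is an `A`-th root of unity, `ζ ^ e` a `B`-th root of unity
  have hf : (ζ ^ f) ^ A = 1 := by
    obtain ⟨c, hc⟩ := (Nat.modEq_zero_iff_dvd.mp hfB)
    rw [← pow_mul, hc, show B * c * A = A * B * c by ring, pow_mul, hζ, one_pow]
  have he : (ζ ^ e) ^ B = 1 := by
    obtain ⟨c, hc⟩ := (Nat.modEq_zero_iff_dvd.mp heA)
    rw [← pow_mul, hc, show A * c * B = A * B * c by ring, pow_mul, hζ, one_pow]
  -- and `ζ = ζ ^ f * ζ ^ e` since `f + e ≡ 1 (mod AB)`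
  have hsum : f + e ≡ 1 [MOD A * B] :=
    (Nat.modEq_and_modEq_iff_modEq_mul hAB).mp ⟨by simpa using hfA.add heA, by simpa using hfB.add heB⟩
  have hζeq : ζ ^ f * ζ ^ e = ζ := by
    rw [← pow_add, pow_eq_pow_mod _ hζ, hsum, ← pow_eq_pow_mod _ hζ, pow_one]
  rw [← hζeq, smul_mul', hA _ hf, hB _ he]

/-- If `σ ∈ Γ_K` fixes the `q^k`-th roots of unity of `K̄` for every prime `q ∣ m` and every `k`,
then it fixes the `m`-th roots of unity (`m ≥ 1`; induction on the factorisation of `m` using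
`smul_eq_self_of_coprime`). [folklore] -/
theorem smul_eq_self_of_forall_prime {m : ℕ} (hm : m ≠ 0) (σ : absoluteGaloisGroup K)
    (h : ∀ q : ℕ, q.Prime → q ∣ m →
      ∀ (k : ℕ) (ζ : AlgebraicClosure K), ζ ^ q ^ k = 1 → σ • ζ = ζ)
    (ζ : AlgebraicClosure K) (hζ : ζ ^ m = 1) : σ • ζ = ζ := by
  revert hm h ζ
  refine Nat.recOnPosPrimePosCoprime (fun q n hq hn => ?_) ?_ ?_ (fun a b ha hb hab iha ihb => ?_) m
  · intro _ h ζ hζ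
    exact h q hq (dvd_pow_self q hn.ne') n ζ hζ
  · intro h0
    exact absurd rfl h0
  · intro _ _ ζ hζ
    rw [pow_one] at hζ
    rw [hζ]
    exact smul_one σ
  · intro _ h ζ hζ
    haveI : NeZero a := ⟨by omega⟩
    haveI : NeZero b := ⟨by omega⟩
    exact smul_eq_self_of_coprime hab σ
      (iha (by omega) fun q hq hqa => h q hq (hqa.mul_right b))
      (ihb (by omega) fun q hq hqb => h q hq (hqb.mul_left a)) ζ hζ

section CharZero

variable [CharZero K]

/-- Every `σ ∈ Γ_K` acts on the (cyclic, order `N`) group `μ_N(K̄)` through `(ℤ/Nℤ)ˣ`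
(Mathlib's `modularCyclotomicCharacter`), a group of order `φ(N)`; hence `σ ^ φ(N)` fixes the
`N`-th roots of unity.  Ref: Washington, *Introduction to Cyclotomic Fields*, Ch. 2, Thm. 2.5. [folklore] -/
theorem pow_totient_smul_eq_self {N : ℕ} [NeZero N] (σ : absoluteGaloisGroup K)
    (ζ : AlgebraicClosure K) (hζ : ζ ^ N = 1) : σ ^ Nat.totient N • ζ = ζ := by
  classical
  rcases eq_or_ne N 1 with rfl | hN1
  · rw [pow_one] at hζ
    rw [hζ]
    exact smul_one _
  have hn := HasEnoughRootsOfUnity.natCard_rootsOfUnity (AlgebraicClosure K) N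
  let f : AlgebraicClosure K ≃+* AlgebraicClosure K :=
    MulSemiringAction.toRingAut (absoluteGaloisGroup K) (AlgebraicClosure K) σ
  have hχ : modularCyclotomicCharacter (AlgebraicClosure K) hn (f ^ Nat.totient N) = 1 := by
    rw [map_pow, ← ZMod.card_units_eq_totient N, pow_card_eq_one]
  have hspec := modularCyclotomicCharacter.spec (AlgebraicClosure K) hn (f ^ Nat.totient N)
    (t := (rootsOfUnity.mkOfPowEq ζ hζ : (AlgebraicClosure K)ˣ)) (rootsOfUnity.mkOfPowEq ζ hζ).2
  rw [hχ, Units.val_one, ZMod.val_one'' hN1, pow_one, rootsOfUnity.val_mkOfPowEq_coe] at hspec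
  have hf : (f ^ Nat.totient N) ζ = σ ^ Nat.totient N • ζ := by
    rw [← map_pow]
    rfl
  rwa [hf] at hspec

/-- **Prescribing the action on roots of unity at a finite level.**  Let `A, B ≥ 1` be coprime
and assume `Φ_{AB}` is irreducible over `K` (so that `Gal(K(μ_{AB})/K) ≃ (ℤ/ABℤ)ˣ`,
Mathlib's `IsCyclotomicExtension.autEquivPow`).  For every unit `a mod A` there is `σ ∈ Γ_K`
acting on the `A`-th roots of unity of `K̄` by `ζ ↦ ζᵃ` and trivially on the `B`-th roots of
unity: take the automorphism of `K(μ_{AB}) ⊆ K̄` with exponent `b ≡ a (A)`, `b ≡ 1 (B)` and extend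
it to `K̄` (`AlgEquiv.liftNormal`).
Ref: Washington, *Introduction to Cyclotomic Fields*, Ch. 2, Thm. 2.5 and its proof. [folklore] -/
theorem exists_smul_eq_pow_and_smul_eq_self {A B : ℕ} [NeZero A] [NeZero B] (hAB : A.Coprime B)
    (hirr : Irreducible (cyclotomic (A * B) K)) (a : (ZMod A)ˣ) :
    ∃ σ : absoluteGaloisGroup K,
      (∀ ζ : AlgebraicClosure K, ζ ^ A = 1 → σ • ζ = ζ ^ (a : ZMod A).val) ∧
      (∀ ζ : AlgebraicClosure K, ζ ^ B = 1 → σ • ζ = ζ) := by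
  classical
  haveI hN : NeZero (A * B) := ⟨mul_ne_zero (NeZero.ne A) (NeZero.ne B)⟩
  -- a primitive `AB`-th root of unity `ζ₀ ∈ K̄` and the cyclotomic field `E = K(ζ₀) ⊆ K̄`
  obtain ⟨ζ₀, hζ₀⟩ := HasEnoughRootsOfUnity.exists_primitiveRoot (AlgebraicClosure K) (A * B)
  haveI := hζ₀.intermediateField_adjoin_isCyclotomicExtension K
  -- an exponent `k ≡ a (mod A)`, `k ≡ 1 (mod B)`, a unit modulo `AB`
  obtain ⟨k, hkA, hkB⟩ := Nat.chineseRemainder hAB (a : ZMod A).val 1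
  have hkcop : k.Coprime (A * B) := by
    refine Nat.Coprime.mul_right ?_ ?_
    · rw [Nat.Coprime, hkA.gcd_eq]
      exact ZMod.val_coe_unit_coprime a
    · rw [Nat.Coprime, hkB.gcd_eq, Nat.gcd_one_left]
  -- the automorphism of `E` with exponent `k`
  let g : ↥K⟮ζ₀⟯ ≃ₐ[K] ↥K⟮ζ₀⟯ :=
    (IsCyclotomicExtension.autEquivPow (↥K⟮ζ₀⟯) hirr).symm (ZMod.unitOfCoprime k hkcop)
  have hg : IsCyclotomicExtension.autEquivPow (↥K⟮ζ₀⟯) hirr g = ZMod.unitOfCoprime k hkcop :=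
    MulEquiv.apply_symm_apply _ _
  set μ := IsCyclotomicExtension.zeta (A * B) K ↥K⟮ζ₀⟯
  have hμ := IsCyclotomicExtension.zeta_spec (A * B) K ↥K⟮ζ₀⟯
  have hexp : ((hμ.autToPow K g : (ZMod (A * B))ˣ) : ZMod (A * B)) = (k : ZMod (A * B)) := by
    rw [IsCyclotomicExtension.autEquivPow_apply] at hg
    rw [← ZMod.coe_unitOfCoprime k hkcop, ← hg]
    rfl
  have hgμ : g μ = μ ^ k := by
    rw [← hμ.autToPow_spec K g, hexp, ZMod.val_natCast, ← pow_eq_pow_mod _ hμ.pow_eq_one]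
  -- extend `g` to `K̄`
  let σ : absoluteGaloisGroup K :=
    (absoluteGaloisGroup.toAlgEquiv K).symm (AlgEquiv.liftNormal g (AlgebraicClosure K))
  have hσE : ∀ y : ↥K⟮ζ₀⟯, σ • (y : AlgebraicClosure K) = ((g y : ↥K⟮ζ₀⟯) : AlgebraicClosure K) := by
    intro y
    rw [absoluteGaloisGroup.toAlgEquiv_symm_apply]
    exact AlgEquiv.liftNormal_commutes g (AlgebraicClosure K) y
  have hμ' : IsPrimitiveRoot ((μ : ↥K⟮ζ₀⟯) : AlgebraicClosure K) (A * B) :=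
    IsPrimitiveRoot.coe_submonoidClass_iff.mpr hμ
  -- `σ` raises every `AB`-th root of unity of `K̄` to the `k`-th power
  have hall : ∀ ζ : AlgebraicClosure K, ζ ^ (A * B) = 1 → σ • ζ = ζ ^ k := by
    intro ζ hζ
    obtain ⟨i, -, rfl⟩ := hμ'.eq_pow_of_pow_eq_one hζ
    have h1 : σ • ((μ : ↥K⟮ζ₀⟯) : AlgebraicClosure K) =
        ((μ : ↥K⟮ζ₀⟯) : AlgebraicClosure K) ^ k := by
      rw [hσE, hgμ, SubmonoidClass.coe_pow]
    rw [smul_pow', h1, ← pow_mul, ← pow_mul, mul_comm]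
  refine ⟨σ, fun ζ hζ => ?_, fun ζ hζ => ?_⟩
  · have hζ' : ζ ^ (A * B) = 1 := by rw [pow_mul, hζ, one_pow]
    rw [hall ζ hζ', pow_eq_pow_mod _ hζ, hkA, ← pow_eq_pow_mod _ hζ]
  · have hζ' : ζ ^ (A * B) = 1 := by rw [mul_comm, pow_mul, hζ, one_pow]
    rw [hall ζ hζ', pow_eq_pow_mod _ hζ, hkB, ← pow_eq_pow_mod _ hζ, pow_one]

/-- **Local surjectivity of `Γ_K → ∏_ℓ ℤ_ℓˣ` at one prime.**  Assume all cyclotomic polynomials are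
irreducible over `K`.  For a prime `ℓ` and `τ ∈ Γ_K` there is `σ ∈ Γ_K` acting like `τ` on all
`ℓ`-power roots of unity of `K̄` and trivially on all roots of unity of order prime to `ℓ`.
Proof: the sets `Z_j` of `σ` agreeing with `τ` on `μ_{ℓʲ}` and fixing `μ_{B_j}`, `B_j` the
prime-to-`ℓ` part of `j!`, are closed, decreasing and non-empty
(`exists_smul_eq_pow_and_smul_eq_self`), so they have a common point by compactness of `Γ_K`.
Ref: Washington, *Introduction to Cyclotomic Fields*, Ch. 14, p. 321
(`Gal(ℚ(μ_∞)/ℚ) ≃ ∏_p ℤ_pˣ`). [folklore] -/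
theorem exists_smul_eq_smul_and_smul_eq_self
    (hirr : ∀ n : ℕ, 0 < n → Irreducible (cyclotomic n K)) {ℓ : ℕ} (hℓ : ℓ.Prime)
    (τ : absoluteGaloisGroup K) :
    ∃ σ : absoluteGaloisGroup K,
      (∀ (k : ℕ) (ζ : AlgebraicClosure K), ζ ^ ℓ ^ k = 1 → σ • ζ = τ • ζ) ∧
      (∀ m : ℕ, ℓ.Coprime m → ∀ ζ : AlgebraicClosure K, ζ ^ m = 1 → σ • ζ = ζ) := by
  classical
  haveI : Fact ℓ.Prime := ⟨hℓ⟩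
  haveI : NeZero ℓ := ⟨hℓ.ne_zero⟩
  -- the prime-to-`ℓ` parts `B j` of `j!`
  let B : ℕ → ℕ := fun j => Nat.factorial j / ℓ ^ (Nat.factorial j).factorization ℓ
  have hB0 : ∀ j, B j ≠ 0 := fun j => (Nat.ordCompl_pos ℓ (Nat.factorial_ne_zero j)).ne'
  have hBcop : ∀ j, ℓ.Coprime (B j) := fun j => Nat.coprime_ordCompl hℓ (Nat.factorial_ne_zero j)
  have hBmono : ∀ j, B j ∣ B (j + 1) := fun j =>
    Nat.ordCompl_dvd_ordCompl_of_dvd (Nat.factorial_dvd_factorial (Nat.le_succ j)) ℓ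
  let Z : ℕ → Set (absoluteGaloisGroup K) := fun j =>
    {σ | ∀ ζ : AlgebraicClosure K, ζ ^ ℓ ^ j = 1 → σ • ζ = τ • ζ} ∩
      {σ | ∀ ζ : AlgebraicClosure K, ζ ^ B j = 1 → σ • ζ = ζ}
  have hZclosed : ∀ j, IsClosed (Z j) := fun j =>
    (isClosed_setOf_forall_smul_eq (ℓ ^ j) fun ζ => τ • ζ).inter
      (isClosed_setOf_forall_smul_eq (B j) id)
  have hZanti : ∀ j, Z (j + 1) ⊆ Z j := by
    intro j σ hσ
    refine ⟨fun ζ hζ => hσ.1 ζ ?_, fun ζ hζ => hσ.2 ζ ?_⟩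
    · rw [pow_succ, pow_mul, hζ, one_pow]
    · obtain ⟨c, hc⟩ := hBmono j
      rw [hc, pow_mul, hζ, one_pow]
  have hZne : ∀ j, (Z j).Nonempty := by
    intro j
    haveI : NeZero (ℓ ^ j) := ⟨pow_ne_zero _ hℓ.ne_zero⟩
    haveI : NeZero (B j) := ⟨hB0 j⟩
    have hcop : (ℓ ^ j).Coprime (B j) := (hBcop j).pow_left j
    obtain ⟨σ, hσA, hσB⟩ := exists_smul_eq_pow_and_smul_eq_self hcop
      (hirr _ (Nat.pos_of_ne_zero (mul_ne_zero (NeZero.ne _) (hB0 j))))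
      (Units.map (PadicInt.toZModPow j).toMonoidHom (GaloisRep.cyclotomicCharacter K ℓ τ))
    refine ⟨σ, fun ζ hζ => ?_, hσB⟩
    rw [hσA ζ hζ, GaloisRep.cyclotomicCharacter_spec K ℓ τ ζ hζ]
    rfl
  obtain ⟨σ, hσ⟩ := IsCompact.nonempty_iInter_of_sequence_nonempty_isCompact_isClosed Z hZanti
    hZne (hZclosed 0).isCompact hZclosed
  rw [Set.mem_iInter] at hσ
  refine ⟨σ, fun k => (hσ k).1, fun m hm ζ hζ => ?_⟩
  have hm0 : m ≠ 0 := by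
    rintro rfl
    exact hℓ.one_lt.ne' (Nat.Coprime.eq_one_of_dvd hm (dvd_zero ℓ))
  have hdvd : m ∣ B m := by
    have h1 : m ∣ Nat.factorial m := Nat.dvd_factorial (Nat.pos_of_ne_zero hm0) le_rfl
    rw [← Nat.ordProj_mul_ordCompl_eq_self (Nat.factorial m) ℓ] at h1
    exact (Nat.Coprime.pow_right _ hm.symm).dvd_of_dvd_mul_left h1
  obtain ⟨c, hc⟩ := hdvd
  exact (hσ m).2 ζ (by rw [hc, pow_mul, hζ, one_pow])

end CharZero

end RootOfUnityAction

namespace GaloisRep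

open RootOfUnityAction

variable (K : Type u) [Field K] [CharZero K] (p : ℕ) [Fact p.Prime]

/-- If `χ_p(σ) = 1` then `σ` fixes every `p`-power root of unity of `K̄` (the defining property
of the cyclotomic character, `GaloisRep.cyclotomicCharacter_spec`).
Ref: Serre, *Abelian ℓ-adic representations* (1968), Ch. I §1.2. [folklore] -/
theorem smul_eq_self_of_cyclotomicCharacter_eq_one {σ : absoluteGaloisGroup K}
    (hσ : GaloisRep.cyclotomicCharacter K p σ = 1) (k : ℕ) (ζ : AlgebraicClosure K)
    (hζ : ζ ^ p ^ k = 1) : σ • ζ = ζ := by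
  have hp : p.Prime := Fact.out
  haveI : NeZero p := ⟨hp.ne_zero⟩
  rw [GaloisRep.cyclotomicCharacter_spec K p σ ζ hζ, hσ, Units.val_one, map_one]
  rcases Nat.eq_zero_or_pos k with rfl | hk
  · rw [pow_zero, pow_one] at hζ
    rw [hζ, one_pow]
  · rw [ZMod.val_one'' (Nat.one_lt_pow hk.ne' hp.one_lt).ne', pow_one]

/-- **Surjectivity of the cyclotomic character.**  If every cyclotomic polynomial is irreducible
over `K` (e.g. `K = ℚ`), the `p`-adic cyclotomic character `χ_p : Γ_K →ₜ* ℤ_pˣ` is surjective: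
its image is closed (compactness) and meets every residue class modulo `pⁿ`
(`Gal(K(μ_{pⁿ})/K) ≃ (ℤ/pⁿℤ)ˣ`).
Ref: Washington, *Introduction to Cyclotomic Fields*, Ch. 14, p. 321; Serre, *Abelian ℓ-adic
representations* (1968), Ch. I §1.2. [folklore] -/
theorem cyclotomicCharacter_surjective (hirr : ∀ n : ℕ, 0 < n → Irreducible (cyclotomic n K)) :
    Function.Surjective (GaloisRep.cyclotomicCharacter K p) := by
  classical
  have hp : p.Prime := Fact.out
  haveI : NeZero p := ⟨hp.ne_zero⟩
  intro u
  let Z : ℕ → Set (absoluteGaloisGroup K) := fun j =>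
    {σ | ∀ ζ : AlgebraicClosure K, ζ ^ p ^ j = 1 →
      σ • ζ = ζ ^ (PadicInt.toZModPow j (u : ℤ_[p])).val}
  have hZclosed : ∀ j, IsClosed (Z j) := fun j =>
    isClosed_setOf_forall_smul_eq (p ^ j) fun ζ => ζ ^ (PadicInt.toZModPow j (u : ℤ_[p])).val
  have hZanti : ∀ j, Z (j + 1) ⊆ Z j := by
    intro j σ hσ ζ hζ
    have hζ' : ζ ^ p ^ (j + 1) = 1 := by rw [pow_succ, pow_mul, hζ, one_pow]
    rw [hσ ζ hζ', pow_eq_pow_mod _ hζ, pow_eq_pow_mod (PadicInt.toZModPow j (u : ℤ_[p])).val hζ]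
    congr 1
    rw [← ZMod.natCast_eq_natCast_iff', ZMod.natCast_val, ZMod.natCast_zmod_val,
      PadicInt.cast_toZModPow j (j + 1) (Nat.le_succ j)]
  have hZne : ∀ j, (Z j).Nonempty := by
    intro j
    haveI : NeZero (p ^ j) := ⟨pow_ne_zero _ hp.ne_zero⟩
    obtain ⟨σ, hσA, -⟩ := exists_smul_eq_pow_and_smul_eq_self (K := K) (B := 1)
      (Nat.coprime_one_right _) (by rw [mul_one]; exact hirr _ (pow_pos hp.pos j))
      (Units.map (PadicInt.toZModPow j).toMonoidHom u)
    exact ⟨σ, hσA⟩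
  obtain ⟨σ, hσ⟩ := IsCompact.nonempty_iInter_of_sequence_nonempty_isCompact_isClosed Z hZanti
    hZne (hZclosed 0).isCompact hZclosed
  rw [Set.mem_iInter] at hσ
  refine ⟨σ, Units.ext (PadicInt.ext_of_toZModPow.mp fun n => ?_)⟩
  rw [GaloisRep.cyclotomicCharacter_apply, cyclotomicCharacter.toZModPow]
  symm
  refine modularCyclotomicCharacter.unique (AlgebraicClosure K) _ _ (fun t ht => ?_)
  have ht' : ((t : (AlgebraicClosure K)ˣ) : AlgebraicClosure K) ^ p ^ n = 1 := by
    have := congrArg Units.val ((mem_rootsOfUnity _ t).mp ht)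
    simpa using this
  exact hσ n _ ht'

/-- **Characters trivial on `ker χ_p` factor through `χ_p`.**  Under the same irreducibility
hypothesis, a continuous homomorphism `F : Γ_K →ₜ* M` with `F = 1` on `ker χ_p` is `g ∘ χ_p` for a
(unique) continuous homomorphism `g : ℤ_pˣ →ₜ* M`: `χ_p` is surjective
(`cyclotomicCharacter_surjective`) and a quotient map (a continuous surjection from a compact
space to a Hausdorff space).  Ref: Washington, *Introduction to Cyclotomic Fields*, §13.1
(the `ℤ_p`-extensions of `ℚ` inside `ℚ(μ_{p^∞})`). [folklore] -/
theorem exists_continuousMonoidHom_comp_cyclotomicCharacter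
    (hirr : ∀ n : ℕ, 0 < n → Irreducible (cyclotomic n K))
    {M : Type*} [Group M] [TopologicalSpace M] (F : absoluteGaloisGroup K →ₜ* M)
    (hF : ∀ σ, GaloisRep.cyclotomicCharacter K p σ = 1 → F σ = 1) :
    ∃ g : ℤ_[p]ˣ →ₜ* M, ∀ σ, g (GaloisRep.cyclotomicCharacter K p σ) = F σ := by
  set χ := GaloisRep.cyclotomicCharacter K p
  have hsurj : Function.Surjective χ := cyclotomicCharacter_surjective K p hirr
  have hker : χ.toMonoidHom.ker ≤ F.toMonoidHom.ker := fun σ hσ => hF σ hσ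
  have hs : Function.RightInverse (Function.surjInv hsurj) χ.toMonoidHom :=
    Function.rightInverse_surjInv hsurj
  let g₀ : ℤ_[p]ˣ →* M :=
    MonoidHom.liftOfRightInverse χ.toMonoidHom (Function.surjInv hsurj) hs ⟨F.toMonoidHom, hker⟩
  have hg₀ : ∀ σ, g₀ (χ σ) = F σ := fun σ =>
    MonoidHom.liftOfRightInverse_comp_apply χ.toMonoidHom (Function.surjInv hsurj) hs
      ⟨F.toMonoidHom, hker⟩ σ
  have hq : Topology.IsQuotientMap χ :=
    (χ.continuous.isClosedMap).isQuotientMap χ.continuous hsurj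
  have hcont : Continuous g₀ := by
    rw [hq.continuous_iff]
    have hcomp : (g₀ : ℤ_[p]ˣ → M) ∘ χ = F := funext hg₀
    rw [hcomp]
    exact F.continuous
  exact ⟨{ g₀ with continuous_toFun := hcont }, hg₀⟩

end GaloisRep

end Literature.NumberTheory.GaloisRepresentations
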